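import Summits.BirchSwinnertonDyer.BirchSwinnertonDyer.Theses.PrintCf2
import Summits.BirchSwinnertonDyer.BirchSwinnertonDyer.Theorems.PrintCf2RamifiedOffTYZSquareSilenceThreeCycle
import HarnessLib

/-!
# Route `PrintCf2`, aside stmt-BirchSwinnertonDyer-23442 `RamifiedLowerHalfThreeCycleOfFacts` — CLOSER BY NAME

The aside filed by planner g21 (route A rev 52) under crux stmt-BirchSwinnertonDyer-20509 / item 23431 (C⁺ lower half, `k = 3`
even cell `(3,3,3)`): for square-free `n = 2abc` with `a ≡ b ≡ c ≡ 3 (mod 8)` and the 3-cycle of Legendre symbols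
`(b/a) = (c/b) = (a/c) = 1`, `ord_{s=1} L(E_n, s) = 1` and a generator `(x, y)` of `E_n(ℚ)` modulo torsion with
`x ∉ {±1, ±n, ±2, ±2n}·ℚ²`, every TYZ value `𝓛(n)` is even — modulo `tyz_cmPointRingClassFrobeniusValueData ∧
thm11_parity_of_scriptL ∧ rank_eq_analyticRank_of_analyticRank_le_one`.  Proved BY NAME by
`Summit.BirchSwinnertonDyer.PrintCf2.ThreeCycle.two_dvd_scriptL_three_cycle_of_facts` of the crux LEAD (cruxlead-20509 g13,
p743485), whose type is the item text VERBATIM.  CONDITIONAL on the three named facts (hypotheses of the statement, no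
`_holds`); crux 20509 / item 23431 are NOT closed by this file; BSD is not proved by any of this.

References: [cite: TianYuanZhang2017, Thm. 3.5, Lemma 3.18, §3.1, Prop. 3.2 (2), Thm. 3.6 (2), proof of Lemma 3.21];
[cite: Cox2013, §1 (1.13)–(1.15), §5.C Lemma 5.19, (5.22), §9.A]; [cite: HeathBrown1994SelmerCongruentII, Appendix (Monsky)];
[cite: Darmon2004, Thm. 3.22].
-/

set_option linter.dupNamespace false

namespace Summit.BirchSwinnertonDyer.BirchSwinnertonDyer.Theorems

/-- **Aside `RamifiedLowerHalfThreeCycleOfFacts` (stmt-BirchSwinnertonDyer-23442), by name**: cell `(3,3,3)` of the `k = 3`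
even lower half of C⁺ — `n = 2abc`, `a ≡ b ≡ c ≡ 3 (mod 8)`, `(b/a) = (c/b) = (a/c) = 1`, `ord_{s=1} L(E_n, s) = 1`, a
non-special generator of `E_n(ℚ)/tors` ⟹ `2 ∣ L` for every `L` with `IsScriptL n L`, granted the three named facts.
[cite: TianYuanZhang2017, Thm. 3.5, Lemma 3.18, Prop. 3.2 (2), Thm. 3.6 (2), proof of Lemma 3.21]
[cite: Cox2013, §5.C Lemma 5.19, (5.22), §9.A] [cite: Darmon2004, Thm. 3.22] -/
theorem ramifiedLowerHalfThreeCycleOfFacts_proof :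
    Summit.BirchSwinnertonDyer.BirchSwinnertonDyer.Theses.PrintCf2.RamifiedLowerHalfThreeCycleOfFacts := by
  unfold Summit.BirchSwinnertonDyer.BirchSwinnertonDyer.Theses.PrintCf2.RamifiedLowerHalfThreeCycleOfFacts
  exact Summit.BirchSwinnertonDyer.PrintCf2.ThreeCycle.two_dvd_scriptL_three_cycle_of_facts

end Summit.BirchSwinnertonDyer.BirchSwinnertonDyer.Theorems
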